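import Mathlib.LinearAlgebra.FiniteDimensional.Lemmas
import Literature.MathematicalPhysics.QuantumFieldTheory.TorusChartHodge
import HarnessLib

/-!
# The Green's operator of the lattice Laplacian on a finite charted torus

On a finite charted torus (`TorusChart.lean`) the positive lattice Laplacian `−Δ` (`TorusChart.negLap`,
`TorusChartHodge.lean`) is a symmetric positive-semidefinite operator on real `0`-cochains whose kernel is the
constants (`negLap_eq_zero_iff`) and whose range is the mean-zero functions (`sum_negLap`).  By finite-dimensional
linear algebra it is therefore invertible on the mean-zero functions; the inverse, extended by zero on the constants,
is the **Green's operator** `G = TorusChart.green`: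

* `TorusChart.mean f = (Σ_x f x) / |Λ|`; `green f` is the unique mean-zero `u` with `−Δ u = f − mean f`
  (`negLap_green`, `sum_green`, `eq_green`); `green_negLap : G (−Δ f) = f − mean f`;
* `G` is linear (`green_add`, `green_smul`, `green_sub`, `green_neg`, `green_zero`, `green_const`), translation
  covariant (`green_translate`), symmetric (`sum_mul_green_comm`) and positive (`sum_mul_green_self_nonneg`);
* componentwise Green's operators `green₁`, `green₂` on `1`- and `2`-cochains and the commutation rules
  `d₀_green : d₀ (G f) = G (d₀ f)`, `δ₁_green₁ : δ₁ (G ω) = G (δ₁ ω)`, `d₁_green₁ : d₁ (G ω) = G (d₁ ω)`,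
  `δ₂_green₂ : δ₂ (G q) = G (δ₂ q)` (constant-coefficient operators commute), `negLap₁_green₁`, `negLap₂_green₂`.

These are the inputs of the Hodge decomposition `ω = d₀ G δ₁ ω + δ₂ G d₁ ω + mean ω` of
`TorusChartHodgeDecomposition.lean`.

## References
* B. Eckmann, Comment. Math. Helv. 17 (1945) 240–255 (harmonic cochains of a finite complex).
* J. Fröhlich, T. Spencer, Comm. Math. Phys. 83 (1982) 411–454, §2.3–2.5. [FrohlichSpencerCMP1982]
-/

noncomputable section

namespace Literature.MathematicalPhysics.QuantumFieldTheory

open scoped BigOperators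

namespace TorusChart

variable {Λ : Type*} [AddCommGroup Λ] {d : ℕ} (F : TorusChart Λ d)

/-! ## The Laplacian as a linear map, means, the mean-zero subspace -/

/-- `−Δ` is homogeneous over `ℝ`. [folklore] -/
theorem negLap_smul (c : ℝ) (f : Λ → ℝ) : F.negLap (c • f) = c • F.negLap f := by
  funext x
  simp only [negLap_apply, Pi.smul_apply, smul_eq_mul, Finset.mul_sum, mul_add, mul_sub]

/-- The Laplacian as an `ℝ`-linear endomorphism of the `0`-cochains. [folklore] -/
def negLapₗ : (Λ → ℝ) →ₗ[ℝ] (Λ → ℝ) where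
  toFun := F.negLap
  map_add' := F.negLap_add
  map_smul' := F.negLap_smul

/-- Unfolding `negLapₗ`. [folklore] -/
@[simp] theorem negLapₗ_apply (f : Λ → ℝ) : F.negLapₗ f = F.negLap f := rfl

variable [Fintype Λ]


omit [AddCommGroup Λ] in
/-- The mean of a real function on the finite torus. [folklore] -/
def mean (f : Λ → ℝ) : ℝ := (∑ x, f x) / Fintype.card Λ

omit [AddCommGroup Λ] in
/-- Unfolding `mean`. [folklore] -/
theorem mean_def (f : Λ → ℝ) : mean f = (∑ x, f x) / Fintype.card Λ := rfl

/-- The cardinality of the torus is a positive real. [folklore] -/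
theorem card_pos_real : (0 : ℝ) < Fintype.card Λ := by
  exact_mod_cast (Fintype.card_pos : 0 < Fintype.card Λ)

/-- `Σ_x (f x − mean f) = 0`. [folklore] -/
theorem sum_sub_mean (f : Λ → ℝ) : ∑ x, (f x - mean f) = 0 := by
  rw [Finset.sum_sub_distrib, Finset.sum_const, Finset.card_univ, nsmul_eq_mul, mean_def,
    mul_div_cancel₀ _ (card_pos_real (Λ := Λ)).ne', sub_self]

omit [AddCommGroup Λ] in
/-- A function with zero total has zero mean. [folklore] -/
theorem mean_eq_zero_of_sum_eq_zero {f : Λ → ℝ} (h : ∑ x, f x = 0) : mean f = 0 := by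
  rw [mean_def, h, zero_div]

omit [AddCommGroup Λ] in
/-- The mean is additive. [folklore] -/
theorem mean_add (f g : Λ → ℝ) : mean (f + g) = mean f + mean g := by
  simp only [mean_def, Pi.add_apply, Finset.sum_add_distrib, add_div]

omit [AddCommGroup Λ] in
/-- The mean is homogeneous. [folklore] -/
theorem mean_smul (c : ℝ) (f : Λ → ℝ) : mean (c • f) = c * mean f := by
  simp only [mean_def, Pi.smul_apply, smul_eq_mul, ← Finset.mul_sum, mul_div_assoc]

omit [AddCommGroup Λ] in
/-- The mean of a negative. [folklore] -/
theorem mean_neg (f : Λ → ℝ) : mean (-f) = -mean f := by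
  simp only [mean_def, Pi.neg_apply, Finset.sum_neg_distrib, neg_div]

omit [AddCommGroup Λ] in
/-- The mean of a difference. [folklore] -/
theorem mean_sub (f g : Λ → ℝ) : mean (f - g) = mean f - mean g := by
  rw [sub_eq_add_neg, mean_add, mean_neg, ← sub_eq_add_neg]

/-- The mean of a constant. [folklore] -/
theorem mean_const (a : ℝ) : mean (fun _ : Λ => a) = a := by
  rw [mean_def, Finset.sum_const, Finset.card_univ, nsmul_eq_mul, mul_div_cancel_left₀ _ (card_pos_real (Λ := Λ)).ne']

/-- The mean is translation invariant. [folklore] -/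
theorem mean_translate (f : Λ → ℝ) (v : Λ) : mean (fun x => f (x + v)) = mean f := by
  rw [mean_def, mean_def, sum_comp_add_eq]

/-- The Laplacian has zero mean. [folklore] -/
theorem mean_negLap (f : Λ → ℝ) : mean (F.negLap f) = 0 :=
  mean_eq_zero_of_sum_eq_zero (F.sum_negLap f)

omit [AddCommGroup Λ] in
/-- The total-sum functional. [folklore] -/
def totalₗ : (Λ → ℝ) →ₗ[ℝ] ℝ where
  toFun f := ∑ x, f x
  map_add' f g := by simp [Finset.sum_add_distrib]
  map_smul' c f := by simp [Finset.mul_sum]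

omit [AddCommGroup Λ] in
/-- Unfolding `totalₗ`. [folklore] -/
@[simp] theorem totalₗ_apply (f : Λ → ℝ) : totalₗ f = ∑ x, f x := rfl

omit [AddCommGroup Λ] in
/-- The **mean-zero subspace** of the real `0`-cochains. [folklore] -/
def meanZero : Submodule ℝ (Λ → ℝ) := LinearMap.ker (totalₗ (Λ := Λ))

omit [AddCommGroup Λ] in
/-- Membership in the mean-zero subspace. [folklore] -/
theorem mem_meanZero_iff (f : Λ → ℝ) : f ∈ meanZero ↔ ∑ x, f x = 0 := by
  rw [meanZero, LinearMap.mem_ker, totalₗ_apply]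

/-- The Laplacian maps into the mean-zero subspace. [folklore] -/
theorem negLap_mem_meanZero (f : Λ → ℝ) : F.negLap f ∈ meanZero :=
  (mem_meanZero_iff _).2 (F.sum_negLap f)

/-- `f − mean f` is mean-zero. [folklore] -/
theorem sub_mean_mem_meanZero (f : Λ → ℝ) : (fun x => f x - mean f) ∈ meanZero :=
  (mem_meanZero_iff _).2 (sum_sub_mean f)

/-- The Laplacian restricted to an endomorphism of the mean-zero subspace. [folklore] -/
def negLapRestrict : meanZero (Λ := Λ) →ₗ[ℝ] meanZero (Λ := Λ) :=
  F.negLapₗ.restrict fun f _ => F.negLap_mem_meanZero f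

/-- Unfolding `negLapRestrict`. [folklore] -/
theorem negLapRestrict_apply (u : meanZero (Λ := Λ)) : (F.negLapRestrict u : Λ → ℝ) = F.negLap u := rfl

/-- **`−Δ` is injective on mean-zero functions** (its kernel is the constants). [folklore] -/
theorem negLapRestrict_injective : Function.Injective F.negLapRestrict := by
  rw [← LinearMap.ker_eq_bot, LinearMap.ker_eq_bot']
  intro u hu
  have h1 : F.negLap (u : Λ → ℝ) = 0 := by
    have := congrArg (fun v : meanZero (Λ := Λ) => (v : Λ → ℝ)) hu
    simpa [negLapRestrict_apply] using this
  have h2 : (u : Λ → ℝ) = 0 :=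
    F.eq_zero_of_negLap_eq_zero_of_sum_eq_zero h1 ((mem_meanZero_iff _).1 u.2)
  exact Subtype.ext h2

/-- **`−Δ` is bijective on mean-zero functions** (finite dimension). [folklore] -/
theorem negLapRestrict_bijective : Function.Bijective F.negLapRestrict :=
  ⟨F.negLapRestrict_injective, LinearMap.injective_iff_surjective.1 F.negLapRestrict_injective⟩

/-- `−Δ` as a linear automorphism of the mean-zero subspace. [folklore] -/
def negLapEquiv : meanZero (Λ := Λ) ≃ₗ[ℝ] meanZero (Λ := Λ) :=
  LinearEquiv.ofBijective F.negLapRestrict F.negLapRestrict_bijective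

/-- Unfolding `negLapEquiv`. [folklore] -/
theorem negLapEquiv_apply (u : meanZero (Λ := Λ)) : (F.negLapEquiv u : Λ → ℝ) = F.negLap u := rfl

/-! ## The Green's operator -/

/-- **The Green's operator** of `−Δ` on the finite torus: `green f` is the unique mean-zero solution `u` of
`−Δ u = f − mean f` (the inverse of `−Δ` on mean-zero functions, extended by zero on constants). [folklore] -/
def green (f : Λ → ℝ) : Λ → ℝ :=
  (F.negLapEquiv.symm ⟨fun x => f x - mean f, sub_mean_mem_meanZero f⟩ : meanZero (Λ := Λ))

/-- `green f` is mean-zero: `Σ_x green f x = 0`. [folklore] -/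
theorem sum_green (f : Λ → ℝ) : ∑ x, F.green f x = 0 :=
  (mem_meanZero_iff _).1 (F.negLapEquiv.symm ⟨fun x => f x - mean f, sub_mean_mem_meanZero f⟩).2

/-- `green f` has zero mean. [folklore] -/
theorem mean_green (f : Λ → ℝ) : mean (F.green f) = 0 :=
  mean_eq_zero_of_sum_eq_zero (F.sum_green f)

/-- **`−Δ (G f) = f − mean f`.** [folklore] -/
theorem negLap_green (f : Λ → ℝ) : F.negLap (F.green f) = fun x => f x - mean f := by
  have h := F.negLapEquiv.apply_symm_apply ⟨fun x => f x - mean f, sub_mean_mem_meanZero f⟩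
  have h' := congrArg (fun v : meanZero (Λ := Λ) => (v : Λ → ℝ)) h
  simp only [negLapEquiv_apply] at h'
  exact h'

/-- Pointwise form of `negLap_green`. [folklore] -/
theorem negLap_green_apply (f : Λ → ℝ) (x : Λ) : F.negLap (F.green f) x = f x - mean f :=
  congr_fun (F.negLap_green f) x

/-- **Uniqueness**: a mean-zero `u` with `−Δ u = f − mean f` is `G f`. [folklore] -/
theorem eq_green {f u : Λ → ℝ} (hsum : ∑ x, u x = 0) (hlap : F.negLap u = fun x => f x - mean f) :
    u = F.green f := by
  have hu : (⟨u, (mem_meanZero_iff _).2 hsum⟩ : meanZero (Λ := Λ)) =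
      ⟨F.green f, (mem_meanZero_iff _).2 (F.sum_green f)⟩ := by
    apply F.negLapRestrict_injective
    apply Subtype.ext
    rw [negLapRestrict_apply, negLapRestrict_apply]
    change F.negLap u = F.negLap (F.green f)
    rw [hlap, negLap_green]
  exact congrArg (fun v : meanZero (Λ := Λ) => (v : Λ → ℝ)) hu

/-- Uniqueness for mean-zero right-hand sides: if `Σ f = 0`, `Σ u = 0` and `−Δ u = f` then `u = G f`. [folklore] -/
theorem eq_green_of_sum_eq_zero {f u : Λ → ℝ} (hf : ∑ x, f x = 0) (hsum : ∑ x, u x = 0)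
    (hlap : F.negLap u = f) : u = F.green f :=
  F.eq_green hsum (by rw [hlap, mean_eq_zero_of_sum_eq_zero hf]; funext x; simp)

/-- For a mean-zero right-hand side, `−Δ (G f) = f`. [folklore] -/
theorem negLap_green_of_sum_eq_zero {f : Λ → ℝ} (hf : ∑ x, f x = 0) : F.negLap (F.green f) = f := by
  rw [negLap_green, mean_eq_zero_of_sum_eq_zero hf]; funext x; simp

/-- **`G (−Δ f) = f − mean f`.** [folklore] -/
theorem green_negLap (f : Λ → ℝ) : F.green (F.negLap f) = fun x => f x - mean f := by
  symm
  refine F.eq_green_of_sum_eq_zero (F.sum_negLap f) (sum_sub_mean f) ?_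
  have : (fun x => f x - mean f) = f - fun _ => mean f := rfl
  rw [this, negLap_sub, negLap_const, sub_zero]

/-- `G` is additive. [folklore] -/
theorem green_add (f g : Λ → ℝ) : F.green (f + g) = F.green f + F.green g := by
  symm
  refine F.eq_green ?_ ?_
  · simp only [Pi.add_apply, Finset.sum_add_distrib, sum_green, add_zero]
  · rw [negLap_add, negLap_green, negLap_green, mean_add]
    funext x; simp only [Pi.add_apply]; ring

/-- `G` is homogeneous. [folklore] -/
theorem green_smul (c : ℝ) (f : Λ → ℝ) : F.green (c • f) = c • F.green f := by
  symm
  refine F.eq_green ?_ ?_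
  · simp only [Pi.smul_apply, smul_eq_mul, ← Finset.mul_sum, sum_green, mul_zero]
  · rw [negLap_smul, negLap_green, mean_smul]
    funext x; simp only [Pi.smul_apply, smul_eq_mul]; ring

/-- `G` commutes with negation. [folklore] -/
theorem green_neg (f : Λ → ℝ) : F.green (-f) = -F.green f := by
  rw [← neg_one_smul ℝ f, green_smul, neg_one_smul]

/-- `G` is subtractive. [folklore] -/
theorem green_sub (f g : Λ → ℝ) : F.green (f - g) = F.green f - F.green g := by
  rw [sub_eq_add_neg, green_add, green_neg, ← sub_eq_add_neg]

/-- `G 0 = 0`. [folklore] -/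
@[simp] theorem green_zero : F.green (0 : Λ → ℝ) = 0 := by
  symm
  refine F.eq_green (by simp) ?_
  rw [negLap_zero]; funext x; simp [mean_def]

/-- `G` kills constants. [folklore] -/
@[simp] theorem green_const (a : ℝ) : F.green (fun _ : Λ => a) = 0 := by
  symm
  refine F.eq_green (by simp) ?_
  rw [negLap_zero, mean_const]; funext x; simp

/-- `G` depends only on `f − mean f`: adding a constant does not change `G f`. [folklore] -/
theorem green_add_const (f : Λ → ℝ) (a : ℝ) : F.green (fun x => f x + a) = F.green f := by
  have : (fun x => f x + a) = f + fun _ => a := rfl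
  rw [this, green_add, green_const, add_zero]

/-- **Translation covariance**: `G (f (· + v)) = (G f) (· + v)`. [folklore] -/
theorem green_translate (f : Λ → ℝ) (v : Λ) : F.green (fun x => f (x + v)) = fun x => F.green f (x + v) := by
  symm
  refine F.eq_green ?_ ?_
  · rw [sum_comp_add_eq]; exact F.sum_green f
  · rw [negLap_translate, negLap_green, mean_translate]

/-- **Symmetry of `G`**: `Σ_x f x · G g x = Σ_x G f x · g x`. [folklore] -/
theorem sum_mul_green_comm (f g : Λ → ℝ) : ∑ x, f x * F.green g x = ∑ x, F.green f x * g x := by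
  have hf : ∀ x, f x = F.negLap (F.green f) x + mean f := fun x => by rw [negLap_green_apply]; ring
  have hg : ∀ x, g x = F.negLap (F.green g) x + mean g := fun x => by rw [negLap_green_apply]; ring
  calc ∑ x, f x * F.green g x = ∑ x, (F.negLap (F.green f) x + mean f) * F.green g x :=
        Finset.sum_congr rfl fun x _ => by rw [← hf x]
    _ = ∑ x, F.negLap (F.green f) x * F.green g x + mean f * ∑ x, F.green g x := by
        simp only [add_mul, Finset.sum_add_distrib, Finset.mul_sum]
    _ = ∑ x, F.green f x * F.negLap (F.green g) x := by
        rw [sum_green, mul_zero, add_zero, ← sum_mul_negLap_comm]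
    _ = ∑ x, F.green f x * F.negLap (F.green g) x + (∑ x, F.green f x) * mean g := by
        rw [sum_green, zero_mul, add_zero]
    _ = ∑ x, F.green f x * (F.negLap (F.green g) x + mean g) := by
        simp only [mul_add, Finset.sum_add_distrib, Finset.sum_mul]
    _ = ∑ x, F.green f x * g x := Finset.sum_congr rfl fun x _ => by rw [← hg x]

/-- **Positivity of `G`**: `Σ_x f x · G f x = ‖d₀ (G f)‖² ≥ 0`. [folklore] -/
theorem sum_mul_green_eq (f : Λ → ℝ) :
    ∑ x, f x * F.green f x = ∑ x, ∑ i, F.d₀ (F.green f) x i * F.d₀ (F.green f) x i := by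
  have hf : ∀ x, f x = F.negLap (F.green f) x + mean f := fun x => by rw [negLap_green_apply]; ring
  calc ∑ x, f x * F.green f x = ∑ x, (F.negLap (F.green f) x + mean f) * F.green f x :=
        Finset.sum_congr rfl fun x _ => by rw [← hf x]
    _ = ∑ x, F.negLap (F.green f) x * F.green f x + mean f * ∑ x, F.green f x := by
        simp only [add_mul, Finset.sum_add_distrib, Finset.mul_sum]
    _ = ∑ x, F.green f x * F.negLap (F.green f) x := by
        rw [sum_green, mul_zero, add_zero]
        exact Finset.sum_congr rfl fun x _ => mul_comm _ _
    _ = ∑ x, ∑ i, F.d₀ (F.green f) x i * F.d₀ (F.green f) x i := F.sum_mul_negLap _ _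

/-- Positivity of `G`. [folklore] -/
theorem sum_mul_green_self_nonneg (f : Λ → ℝ) : 0 ≤ ∑ x, f x * F.green f x := by
  rw [sum_mul_green_eq]
  exact Finset.sum_nonneg fun x _ => Finset.sum_nonneg fun i _ => mul_self_nonneg _

/-! ## Componentwise Green's operators and commutation with `d` and `δ` -/

/-- The Green's operator acting componentwise on `1`-cochains. [folklore] -/
def green₁ (ω : Λ → Fin d → ℝ) : Λ → Fin d → ℝ := fun x i => F.green (fun y => ω y i) x

/-- The Green's operator acting componentwise on `2`-cochains. [folklore] -/
def green₂ (q : Λ → Fin d → Fin d → ℝ) : Λ → Fin d → Fin d → ℝ := fun x i j => F.green (fun y => q y i j) x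

/-- Unfolding `green₁`. [folklore] -/
@[simp] theorem green₁_apply (ω : Λ → Fin d → ℝ) (x : Λ) (i : Fin d) :
    F.green₁ ω x i = F.green (fun y => ω y i) x := rfl

/-- Unfolding `green₂`. [folklore] -/
@[simp] theorem green₂_apply (q : Λ → Fin d → Fin d → ℝ) (x : Λ) (i j : Fin d) :
    F.green₂ q x i j = F.green (fun y => q y i j) x := rfl

/-- The componentwise mean (harmonic part) of a `1`-cochain. [folklore] -/
def harm₁ (ω : Λ → Fin d → ℝ) : Λ → Fin d → ℝ := fun _ i => mean (fun y => ω y i)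

/-- The componentwise mean of a `2`-cochain. [folklore] -/
def harm₂ (q : Λ → Fin d → Fin d → ℝ) : Λ → Fin d → Fin d → ℝ := fun _ i j => mean (fun y => q y i j)

omit [AddCommGroup Λ] in
/-- Unfolding `harm₁`. [folklore] -/
@[simp] theorem harm₁_apply (ω : Λ → Fin d → ℝ) (x : Λ) (i : Fin d) : harm₁ ω x i = mean (fun y => ω y i) := rfl

omit [AddCommGroup Λ] in
/-- Unfolding `harm₂`. [folklore] -/
@[simp] theorem harm₂_apply (q : Λ → Fin d → Fin d → ℝ) (x : Λ) (i j : Fin d) :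
    harm₂ q x i j = mean (fun y => q y i j) := rfl

/-- `−Δ (G ω) = ω − harm ω` on `1`-cochains. [folklore] -/
theorem negLap₁_green₁ (ω : Λ → Fin d → ℝ) : F.negLap₁ (F.green₁ ω) = ω - harm₁ ω := by
  funext x i
  simp only [negLap₁_apply, Pi.sub_apply, harm₁_apply]
  have : (fun y => F.green₁ ω y i) = F.green (fun y => ω y i) := rfl
  rw [this, negLap_green_apply]

/-- `−Δ (G q) = q − harm q` on `2`-cochains. [folklore] -/
theorem negLap₂_green₂ (q : Λ → Fin d → Fin d → ℝ) : F.negLap₂ (F.green₂ q) = q - harm₂ q := by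
  funext x i j
  simp only [negLap₂_apply, Pi.sub_apply, harm₂_apply]
  have : (fun y => F.green₂ q y i j) = F.green (fun y => q y i j) := rfl
  rw [this, negLap_green_apply]

/-- Sums of gradients of `1`-cochain plaquette circulations vanish: `Σ_x d₁ ω (x;i,j) = 0`. [folklore] -/
theorem sum_d₁ {A : Type*} [AddCommGroup A] (ω : Λ → Fin d → A) (i j : Fin d) : ∑ x, F.d₁ ω x i j = 0 := by
  simp only [d₁_apply, Finset.sum_sub_distrib, Finset.sum_add_distrib,
    sum_comp_add_eq (fun x => ω x j) (F.gen i), sum_comp_add_eq (fun x => ω x i) (F.gen j)]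
  abel

/-- **`d₀` commutes with `G`**: `d₀ (G f) = G (d₀ f)` (componentwise on the right). [folklore] -/
theorem d₀_green (f : Λ → ℝ) : F.d₀ (F.green f) = F.green₁ (F.d₀ f) := by
  funext x i
  rw [green₁_apply]
  have hfun : (fun y => F.d₀ (F.green f) y i) = F.green (fun y => F.d₀ f y i) := by
    refine F.eq_green_of_sum_eq_zero (F.sum_d₀ f i) (F.sum_d₀ (F.green f) i) ?_
    have h1 : (fun y => F.d₀ (F.green f) y i) = (fun y => F.green f (y + F.gen i)) - F.green f := by
      funext y; simp
    rw [h1, negLap_sub, negLap_translate, negLap_green]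
    funext y; simp
  exact congr_fun hfun x

/-- **`δ₁` commutes with `G`**: `δ₁ (G ω) = G (δ₁ ω)`. [folklore] -/
theorem δ₁_green₁ (ω : Λ → Fin d → ℝ) : F.δ₁ (F.green₁ ω) = F.green (F.δ₁ ω) := by
  refine F.eq_green_of_sum_eq_zero (F.sum_δ₁ ω) (F.sum_δ₁ _) ?_
  rw [negLap_δ₁, negLap₁_green₁, δ₁_sub]
  have : harm₁ ω = fun _ : Λ => fun i => mean (fun y => ω y i) := rfl
  rw [this, δ₁_const, sub_zero]

/-- **`d₁` commutes with `G`**: `d₁ (G ω) = G (d₁ ω)`. [folklore] -/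
theorem d₁_green₁ (ω : Λ → Fin d → ℝ) : F.d₁ (F.green₁ ω) = F.green₂ (F.d₁ ω) := by
  funext x i j
  rw [green₂_apply]
  have hfun : (fun y => F.d₁ (F.green₁ ω) y i j) = F.green (fun y => F.d₁ ω y i j) := by
    refine F.eq_green_of_sum_eq_zero (F.sum_d₁ ω i j) (F.sum_d₁ _ i j) ?_
    have h1 : F.negLap (fun y => F.d₁ (F.green₁ ω) y i j) = fun y => F.negLap₂ (F.d₁ (F.green₁ ω)) y i j := by
      funext y; rfl
    rw [h1, negLap₂_d₁, negLap₁_green₁, d₁_sub]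
    have : harm₁ ω = fun _ : Λ => fun i => mean (fun y => ω y i) := rfl
    rw [this, d₁_const, sub_zero]
  exact congr_fun hfun x

/-- **`δ₂` commutes with `G`**: `δ₂ (G q) = G (δ₂ q)`. [folklore] -/
theorem δ₂_green₂ (q : Λ → Fin d → Fin d → ℝ) : F.δ₂ (F.green₂ q) = F.green₁ (F.δ₂ q) := by
  funext x i
  rw [green₁_apply]
  have hfun : (fun y => F.δ₂ (F.green₂ q) y i) = F.green (fun y => F.δ₂ q y i) := by
    refine F.eq_green_of_sum_eq_zero (F.sum_δ₂ q i) (F.sum_δ₂ _ i) ?_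
    have h1 : F.negLap (fun y => F.δ₂ (F.green₂ q) y i) = fun y => F.negLap₁ (F.δ₂ (F.green₂ q)) y i := by
      funext y; rfl
    rw [h1, negLap₁_δ₂, negLap₂_green₂, δ₂_sub]
    have : harm₂ q = fun _ : Λ => fun i j => mean (fun y => q y i j) := rfl
    rw [this, δ₂_const, sub_zero]
  exact congr_fun hfun x

/-- `G` on `1`-cochains is additive. [folklore] -/
theorem green₁_add (ω η : Λ → Fin d → ℝ) : F.green₁ (ω + η) = F.green₁ ω + F.green₁ η := by
  funext x i
  simp only [green₁_apply, Pi.add_apply]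
  have : (fun y => ω y i + η y i) = (fun y => ω y i) + fun y => η y i := rfl
  rw [this, green_add, Pi.add_apply]

/-- `G` on `1`-cochains is subtractive. [folklore] -/
theorem green₁_sub (ω η : Λ → Fin d → ℝ) : F.green₁ (ω - η) = F.green₁ ω - F.green₁ η := by
  funext x i
  simp only [green₁_apply, Pi.sub_apply]
  have : (fun y => ω y i - η y i) = (fun y => ω y i) - fun y => η y i := rfl
  rw [this, green_sub, Pi.sub_apply]

/-- `G` on `1`-cochains is homogeneous. [folklore] -/
theorem green₁_smul (c : ℝ) (ω : Λ → Fin d → ℝ) : F.green₁ (c • ω) = c • F.green₁ ω := by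
  funext x i
  simp only [green₁_apply, Pi.smul_apply, smul_eq_mul]
  have : (fun y => c * ω y i) = c • fun y => ω y i := rfl
  rw [this, green_smul, Pi.smul_apply, smul_eq_mul]

/-- `G` on `2`-cochains is additive. [folklore] -/
theorem green₂_add (q p : Λ → Fin d → Fin d → ℝ) : F.green₂ (q + p) = F.green₂ q + F.green₂ p := by
  funext x i j
  simp only [green₂_apply, Pi.add_apply]
  have : (fun y => q y i j + p y i j) = (fun y => q y i j) + fun y => p y i j := rfl
  rw [this, green_add, Pi.add_apply]

/-- `G` on `2`-cochains is homogeneous. [folklore] -/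
theorem green₂_smul (c : ℝ) (q : Λ → Fin d → Fin d → ℝ) : F.green₂ (c • q) = c • F.green₂ q := by
  funext x i j
  simp only [green₂_apply, Pi.smul_apply, smul_eq_mul]
  have : (fun y => c * q y i j) = c • fun y => q y i j := rfl
  rw [this, green_smul, Pi.smul_apply, smul_eq_mul]

/-- `G` kills constant `1`-cochains. [folklore] -/
@[simp] theorem green₁_const (c : Fin d → ℝ) : F.green₁ (fun _ : Λ => c) = 0 := by
  funext x i; simp

/-- `G 0 = 0` on `1`-cochains. [folklore] -/
@[simp] theorem green₁_zero : F.green₁ (0 : Λ → Fin d → ℝ) = 0 := by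
  funext x i; simp

/-- `G ω` has mean zero in every component. [folklore] -/
theorem sum_green₁ (ω : Λ → Fin d → ℝ) (i : Fin d) : ∑ x, F.green₁ ω x i = 0 := by
  simp only [green₁_apply]; exact F.sum_green _

/-- `G q` has mean zero in every component. [folklore] -/
theorem sum_green₂ (q : Λ → Fin d → Fin d → ℝ) (i j : Fin d) : ∑ x, F.green₂ q x i j = 0 := by
  simp only [green₂_apply]; exact F.sum_green _

/-- `G` preserves the alternating property of `2`-cochains: diagonal. [folklore] -/
theorem green₂_self {q : Λ → Fin d → Fin d → ℝ} (h0 : ∀ x i, q x i i = 0) (x : Λ) (i : Fin d) :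
    F.green₂ q x i i = 0 := by
  rw [green₂_apply]
  have : (fun y => q y i i) = fun _ => (0 : ℝ) := funext fun y => h0 y i
  rw [this, green_const]; rfl

/-- `G` preserves the alternating property of `2`-cochains: antisymmetry. [folklore] -/
theorem green₂_swap {q : Λ → Fin d → Fin d → ℝ} (hs : ∀ x i j, q x j i = -q x i j) (x : Λ) (i j : Fin d) :
    F.green₂ q x j i = -F.green₂ q x i j := by
  rw [green₂_apply, green₂_apply]
  have : (fun y => q y j i) = -fun y => q y i j := funext fun y => hs y i j
  rw [this, green_neg]; rfl

end TorusChart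

end Literature.MathematicalPhysics.QuantumFieldTheory

end
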